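import Summits.BirchSwinnertonDyer.BirchSwinnertonDyer.Theses.KolyvaginDepthDoor
import Summits.BirchSwinnertonDyer.BirchSwinnertonDyer.Theorems.KolyvaginDepthDoorKNSupplyLevelOneOfStructure
import Summits.BirchSwinnertonDyer.BirchSwinnertonDyer.Theorems.KolyvaginDepthDoorKNSupplyAnalyticRankLeOne
import Summits.BirchSwinnertonDyer.BirchSwinnertonDyer.Theorems.KolyvaginDepthDoorKNSupplyLargeAdmissiblePrimeSplit
import Summits.BirchSwinnertonDyer.BirchSwinnertonDyer.Theorems.KolyvaginDepthDoorKNSupplyResidualStructureOfPrint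
import Literature.NumberTheory.EllipticCurves.LeadingTerm
import Literature.NumberTheory.EllipticCurves.BSDSha
import HarnessLib

/-!
# Route `KolyvaginDepthDoor`, crux `KolyvaginDepthSupplyKN` (stmt-BirchSwinnertonDyer-22820) —
# COMPOSITION OF LINE `levelone`, SKELETON v8: ONE print route for the whole Kodaira–Néron cell
# (BCGS 2026 Thm. 2 ∘ Zanarella 2019 ∘ Howard–Zanarella rigidity), NO Hypothesis ♠ split, NO W. Zhang fact

Helper file of the lead prover (kdd-p1 g13; `--supports stmt-BirchSwinnertonDyer-22820 --as helper`);
it closes nothing and BSD is not proved by it.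

v5/v6/v7 split the curves of analytic rank `≥ 2` into W. Zhang's ♠ cell (structure statement from the
named fact `WZhang2014_lemma84_exists_minimal_kolyvaginClass_one_selmerCard`, Lemma 8.4 (1) + Thm. 9.1:
level raising, Jacquet–Langlands, Skinner–Urban) and the ♠ (2)-residual (structure statement from
Burungale–Castella–Grossi–Skinner Thm. 2 + Zanarella Prop. 2.18 + the Howard–Zanarella rigidity fact on
a `p`-optimal frame, `modPStructureResidualRankTwo_of_print`, v7). But the second route has NO
square-free / ♠ (2) hypothesis: it serves the WHOLE Kodaira–Néron cell. v8 therefore drops the split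
and W. Zhang's fact: at analytic rank `≥ 2`, for every non-CM curve, the ORDER OF CHOICES of the line
(`K` first by the twist supply; `p` large, admissible Kodaira–Néron and SPLIT in `K`; `Ш(E)[p] = 0`
from the `Ш`-stub; `Ш(E^{(d_K)})[p] = 0` by finiteness; `rank E^{(d_K)} ≤ 1` by GZK) is followed by
the print structure statement `exists_kolyvaginClass_one_selmerCard_of_print` and the route-free
conversion `levelOne_kolyvaginClass_rankClause_of_structure`. Inputs of the composition, exactly:
(1′) «`Ш(E)[p] = 0` for all large `p`» on non-CM curves of analytic rank `≥ 2` (OPEN — the only open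
mathematics); PRINT by name: modularity, Hoffstein–Luo, Bump–Friedberg–Hoffstein, GZK (`rank = ord ∧ Ш
finite` at analytic rank `≤ 1`), Gross–Zagier I.6.3, BCGS Thm. 2, Zanarella Prop. 2.18,
Howard–Zanarella rigidity; BOOKKEEPING: the `p`-optimal frame `hOpt` (open as typed). One XL print
fact FEWER than v7 (no level raising anywhere in the line).

* `kolyvaginDepthSupplyKN_of_hypotheses_primitive` — the v8 composition (crux BY NAME).
* `kolyvaginDepthSupplyKN_of_shaFiniteConjecture_primitive` — the class-wide calibration, v8.

CONDITIONAL on its hypotheses; nothing class-wide is discharged; BSD is NOT proved by this.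

References: [Tate1974] Conj. 1; [BurungaleEtAl2026] Thm. 2 and §1.2; [Zanarella2019] Prop. 2.18,
Cor. 2.12, 2.14, Prop. 2.15; [Howard2004] Thm. 1.4.2, Prop. 1.5.5, Lemma 1.6.4; [GrossZagier1986]
Thm. I.6.3; [BumpFriedbergHoffstein1990]; [HoffsteinLuo1997]; [Darmon2004] Thm. 3.22; [Serre1972] §4.2;
[SilvermanAEC2009] X.4.2; [WZhang2014] Lemma 8.4 (1) (the SHAPE of the structure statement only).
-/

set_option linter.dupNamespace false

noncomputable section

open scoped Classical NumberField

namespace Summit.BirchSwinnertonDyer.BirchSwinnertonDyer.Theorems.KolyvaginDepthDoor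

open Literature.NumberTheory.EllipticCurves Literature.NumberTheory.EllipticCurves.ModularForms
  WeierstrassCurve IsDedekindDomain
open Summit.BirchSwinnertonDyer.BirchSwinnertonDyer.Theorems
open Summit.BirchSwinnertonDyer.BirchSwinnertonDyer.Theses.KolyvaginDepthDoor

/-- A finite subgroup `H ≤ G` with `#H < p`, `p` prime, meets `G[p]` trivially (private restatement
of `KolyvaginDepthDoorKNSupplyCalibration.inf_torsionBy_eq_bot_of_natCard_lt`, keeping this file out of
that file's import cone). [folklore] -/
private theorem inf_torsionBy_eq_bot_of_natCard_lt_aux₈ {G : Type*} [AddCommGroup G]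
    (H : AddSubgroup G) [Finite H] {p : ℕ} (hp : p.Prime) (hlt : Nat.card H < p) :
    (H ⊓ AddSubgroup.torsionBy G (p : ℤ) : AddSubgroup G) = ⊥ := by
  rw [eq_bot_iff]
  intro x hx
  obtain ⟨hxH, hxT⟩ := AddSubgroup.mem_inf.mp hx
  rw [AddSubgroup.mem_bot]
  have hpx : p • x = 0 := AddSubgroup.torsionBy.nsmul_iff.mp hxT
  set y : H := ⟨x, hxH⟩ with hy
  have hpy : p • y = 0 := Subtype.ext (by simp [hy, hpx])
  have hdvd : addOrderOf y ∣ p := addOrderOf_dvd_of_nsmul_eq_zero hpy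
  rcases (Nat.dvd_prime hp).mp hdvd with h1 | hP
  · have : y = 0 := AddMonoid.addOrderOf_eq_one_iff.mp h1
    simpa [hy] using congrArg Subtype.val this
  · exfalso
    have hcard : addOrderOf y ∣ Nat.card H := addOrderOf_dvd_natCard y
    rw [hP] at hcard
    have := Nat.le_of_dvd Nat.card_pos hcard
    omega

/-- **The composition of line `levelone`, SKELETON v8 (sorry-free): `KolyvaginDepthSupplyKN` BY NAME
from** (1′) «`Ш(E)[p] = 0` for all large `p`» on non-CM curves of analytic rank `≥ 2` (OPEN), the
print facts `exists_isNewformOf ∧ HoffsteinLuo1997 ∧ BFH1990 ∧ GZK` and Gross–Zagier I.6.3 (the twist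
supply and the analytic-rank-`≤ 1` slice), the three print facts of the Kodaira–Néron cell — BCGS
2026 Thm. 2, Zanarella 2019 Prop. 2.18, Howard 2004 / Zanarella 2019 mod-`p` rigidity —, and the
`p`-optimal frame `hOpt` (print bookkeeping, open as typed). NO W. Zhang fact, NO Hypothesis ♠ split.
Analytic rank `≤ 1`: `kolyvaginDepthSupplyKN_body_of_analyticRank_le_one`. Analytic rank `≥ 2`: `K`
first (`stub_heegner_field_supply_of_facts`), GZK on the twist, `p` large admissible Kodaira–Néron
split in `K` (`exists_large_admissiblePrime_kodairaNeron_split_of_not_hasCM`), `Ш(E)[p] = 0` (1′),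
`Ш(E^{(d_K)})[p] = 0` (finite of order `< p`), `p ∤ Tam_E` (Kodaira–Néron), the print structure
statement `exists_kolyvaginClass_one_selmerCard_of_print`, and the route-free conversion
`levelOne_kolyvaginClass_rankClause_of_structure`. `#print axioms` standard. CONDITIONAL; BSD is not
proved by it. [cite: BurungaleEtAl2026, Thm. 2 (arXiv:2312.09301 §0.1)] [cite: Zanarella2019, Prop. 2.18, Cor. 2.14]
[cite: Howard2004, Lemma 1.6.4] [cite: GrossZagier1986, Thm. I.6.3 with V.§2] [cite: Darmon2004, Thm. 3.22]
[cite: WZhang2014, Lemma 8.4 (1) (p. 236)] -/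
theorem kolyvaginDepthSupplyKN_of_hypotheses_primitive
    (hSha : ∀ (W : WeierstrassCurve ℚ) [W.IsElliptic] [W.IsGloballyMinimal], ¬ W.HasCM →
      2 ≤ W.analyticRank →
      ∃ B : ℕ, ∀ (p : ℕ) [Fact p.Prime], B < p →
        (W.sha ⊓ AddSubgroup.torsionBy W.galH1 (p : ℤ) : AddSubgroup W.galH1) = ⊥)
    (hPrint : exists_isNewformOf ∧ HoffsteinLuo1997_exists_twist_L_one_ne_zero ∧
      bumpFriedbergHoffstein_exists_heegnerField_split_twist_simpleZero ∧
      rank_eq_analyticRank_of_analyticRank_le_one)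
    (hGZ : ∀ (W : WeierstrassCurve ℚ) (N : ℕ) [NeZero N] (K : Type) [Field K] [NumberField K],
      analyticRankEK_eq_one_iff_heegner_nonTorsion W N K)
    (hRes : BurungaleEtAl2026.thm2_kolyvaginClass_divisibility_eq_padicValNat_tamagawaProduct ∧
      Literature.NumberTheory.EllipticCurves.Zanarella2019_kolyvaginClass_one_ne_zero_of_not_divisible ∧
      Literature.NumberTheory.EllipticCurves.HowardZanarella_exists_minimal_kolyvaginClass_one_selmerCard_of_ne_zero)
    (hOpt : exists_isNewformOf →
      ∀ (W : WeierstrassCurve ℚ) [W.IsElliptic] [W.IsGloballyMinimal] (p : ℕ) [Fact p.Prime],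
        5 ≤ p → W.HasSurjectiveModNGaloisRep p → ∀ [NeZero (W.conductorNorm ℤ)],
          ∃ Dt : ModularParametrizationData W (W.conductorNorm ℤ), Dt.IsPOptimal p) :
    KolyvaginDepthSupplyKN := by
  intro W _ _ hcm
  -- RANK SPLIT: analytic rank `≤ 1` is print
  by_cases hr : W.analyticRank ≤ 1
  · exact kolyvaginDepthSupplyKN_body_of_analyticRank_le_one hPrint hGZ W hcm hr
  obtain ⟨hmod, hHL, hBFH, hGZK⟩ := hPrint
  obtain ⟨h2, hZ, hHZ⟩ := hRes
  have h2an : 2 ≤ W.analyticRank := by omega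
  have hP := exists_large_admissiblePrime_kodairaNeron_of_not_hasCM W hcm
  haveI iNZ : NeZero (W.conductorNorm ℤ) := ⟨(W.conductorNorm_pos_holds).ne'⟩
  -- an auxiliary admissible prime, only to call the HK theorem (its `p`-hypotheses are idle)
  obtain ⟨p₁, hp₁, -, h5₁, hgood₁, hord₁, hsurj₁, -⟩ := hP 0
  haveI := hp₁
  -- `K` FIRST: Heegner, `d_K` odd, `≠ −3, −4`, `ord L(E^{(d_K)}) ≤ 1`
  obtain ⟨K, iF, iN, hK, hD3, hD4, -, hH, hodd, -, hle, -⟩ :=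
    stub_heegner_field_supply_of_facts hmod hHL hBFH W p₁ h5₁ hgood₁ hord₁ hsurj₁
  -- GZK on the twist: rank `≤ 1`, `Ш` finite
  have hdK0 : (NumberField.discr K : ℚ) ≠ 0 := by exact_mod_cast NumberField.discr_ne_zero K
  haveI iT := W.isElliptic_quadraticTwist hdK0
  obtain ⟨hrT, hfinT⟩ := hGZK (W.quadraticTwist (NumberField.discr K : ℚ)) hle
  have hT1 : (W.quadraticTwist (NumberField.discr K : ℚ)).mordellWeilRank ≤ 1 := by
    rw [hrT]; exact hle
  haveI := hfinT
  -- THEN `p` large, admissible Kodaira–Néron and SPLIT in `K`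
  obtain ⟨B₁, hB₁⟩ := hSha W hcm h2an
  obtain ⟨p, hp, hBp, h5, hgood, hord, hsurj, htower, -, hKN, hspl, -⟩ :=
    exists_large_admissiblePrime_kodairaNeron_split_of_not_hasCM W hcm K hK
      (max B₁ (max (NumberField.discr K).natAbs
        (Nat.card ↥(W.quadraticTwist (NumberField.discr K : ℚ)).sha)))
  haveI := hp
  have hpP : p.Prime := hp.out
  have hB₁p : B₁ < p := lt_of_le_of_lt (le_max_left _ _) hBp
  have hdKp : (NumberField.discr K).natAbs < p :=
    lt_of_le_of_lt ((le_max_left _ _).trans (le_max_right _ _)) hBp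
  have hShaTp : Nat.card ↥(W.quadraticTwist (NumberField.discr K : ℚ)).sha < p :=
    lt_of_le_of_lt ((le_max_right _ _).trans (le_max_right _ _)) hBp
  -- `p ∤ d_K`
  have hpD : ¬ ((p : ℤ) ∣ NumberField.discr K) := by
    intro h
    have h1 : p ∣ (NumberField.discr K).natAbs := by
      have := Int.natAbs_dvd_natAbs.mpr h
      simpa using this
    have h2 := Nat.le_of_dvd (Int.natAbs_pos.mpr (NumberField.discr_ne_zero K)) h1
    omega
  -- `(d_K, N) = 1` from the Heegner hypothesis
  have hDN : IsCoprime (NumberField.discr K) ((W.conductorNorm ℤ : ℕ) : ℤ) := by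
    rw [Int.isCoprime_iff_gcd_eq_one, Int.gcd_comm]
    exact Literature.SatisfiesHeegnerHypothesis.coprime_discr hK.1 hH
  -- `Ш(E)[p] = 0` (the `Ш`-stub) and `Ш(E^{(d_K)})[p] = 0` (finite of order `< p`)
  have hshaW := hB₁ p hB₁p
  have hshaT := inf_torsionBy_eq_bot_of_natCard_lt_aux₈
    (W.quadraticTwist (NumberField.discr K : ℚ)).sha hpP hShaTp
  -- `p ∤ Tam_E` on the Kodaira–Néron cell
  have htam : ¬ p ∣ W.tamagawaProduct := not_dvd_tamagawaProduct_of_kodairaNeron W p h5 hKN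
  -- the mod-`p` structure statement at `(E, p, K)`: PRINT on the whole cell (no ♠ split)
  have hstr := exists_kolyvaginClass_one_selmerCard_of_print h2 hZ hHZ W p h5 hgood hord hsurj htower
    htam K hK hH hodd hD3 hD4 hDN hpD hspl (hOpt hmod W p h5 hsurj)
  -- the level-one class with the signed clause, and assembly
  obtain ⟨Dt, β, ι, n, d, hsupp, hne, hclause⟩ :=
    levelOne_kolyvaginClass_rankClause_of_structure W p hsurj K hstr hshaW hshaT hT1
  exact ⟨p, hp, h5, hgood, hord, htower, hKN, K, iF, iN, hK, hD3, hD4, iNZ, hH, Dt, β, ι, n, d,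
    hsupp.1, hsupp.2, hne, hclause⟩

/-- **CLASS-WIDE CALIBRATION, v8.** `KolyvaginDepthSupplyKN` follows from Tate's `ShaFiniteConjecture`
(OPEN, by name; used at analytic rank `≥ 2` only), eight print facts (modularity, Hoffstein–Luo, BFH,
GZK, Gross–Zagier I.6.3, BCGS Thm. 2, Zanarella Prop. 2.18, Howard–Zanarella rigidity), and the
`p`-optimal frame `hOpt` (print bookkeeping). CONDITIONAL; nothing is discharged; BSD is not proved by
it. [cite: Tate1974, Conj. 1] [cite: BurungaleEtAl2026, Thm. 2] [cite: Zanarella2019, Prop. 2.18]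
[cite: Howard2004, Lemma 1.6.4] [cite: GrossZagier1986, Thm. I.6.3] -/
theorem kolyvaginDepthSupplyKN_of_shaFiniteConjecture_primitive (hfin : ShaFiniteConjecture)
    (hPrint : exists_isNewformOf ∧ HoffsteinLuo1997_exists_twist_L_one_ne_zero ∧
      bumpFriedbergHoffstein_exists_heegnerField_split_twist_simpleZero ∧
      rank_eq_analyticRank_of_analyticRank_le_one)
    (hGZ : ∀ (W : WeierstrassCurve ℚ) (N : ℕ) [NeZero N] (K : Type) [Field K] [NumberField K],
      analyticRankEK_eq_one_iff_heegner_nonTorsion W N K)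
    (hRes : BurungaleEtAl2026.thm2_kolyvaginClass_divisibility_eq_padicValNat_tamagawaProduct ∧
      Literature.NumberTheory.EllipticCurves.Zanarella2019_kolyvaginClass_one_ne_zero_of_not_divisible ∧
      Literature.NumberTheory.EllipticCurves.HowardZanarella_exists_minimal_kolyvaginClass_one_selmerCard_of_ne_zero)
    (hOpt : exists_isNewformOf →
      ∀ (W : WeierstrassCurve ℚ) [W.IsElliptic] [W.IsGloballyMinimal] (p : ℕ) [Fact p.Prime],
        5 ≤ p → W.HasSurjectiveModNGaloisRep p → ∀ [NeZero (W.conductorNorm ℤ)],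
          ∃ Dt : ModularParametrizationData W (W.conductorNorm ℤ), Dt.IsPOptimal p) :
    KolyvaginDepthSupplyKN :=
  kolyvaginDepthSupplyKN_of_hypotheses_primitive
    (fun W hE _ _ _ ↦ by
      haveI : Finite W.sha := hfin W hE
      exact ⟨Nat.card ↥W.sha, fun _p hp hB ↦ inf_torsionBy_eq_bot_of_natCard_lt_aux₈ W.sha hp.out hB⟩)
    hPrint hGZ hRes hOpt

end Summit.BirchSwinnertonDyer.BirchSwinnertonDyer.Theorems.KolyvaginDepthDoor

end
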